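import Literature.NumberTheory.EllipticCurves.BSDWave0TunnellProofs
import Literature.NumberTheory.EllipticCurves.BSDAnalyticRankTunnellWaldspurgerProofs
import Literature.NumberTheory.EllipticCurves.ComplexMultiplicationCoatesWiles
import HarnessLib

/-!
# bsd.S29 (Tunnell's theorem, unconditional direction): the current leaves in one statement

Leaf sibling of `Literature.NumberTheory.EllipticCurves.BSDWave0TunnellProofs` (the assembly
`Literature.NumberTheory.EllipticCurves.tunnell_even_of_facts` / `tunnell_odd_of_facts`: Tunnell 1983, §3, p. 329, "From this
[Coates–Wiles] and Theorem 3 we obtain immediately our main result"), composing it with the two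
decompositions the tree has one level further down:

* Coates–Wiles, Theorem 1 (`F = ℚ`) from the three facts of
  `Literature.NumberTheory.EllipticCurves.ComplexMultiplicationCoatesWiles`
  (`Literature.NumberTheory.EllipticCurves.finite_point_of_j_mem_maximalCMJInvariants_of_L_one_ne_zero_of_mem_prime`:
  `𝔭 ∣ Ω⁻¹L(E/ℚ,1)` per split non-anomalous prime, Deuring's `a_p = π + π̄`, the CM period);
* Tunnell's Theorem 3 from the two facts of
  `Literature.NumberTheory.EllipticCurves.BSDAnalyticRankTunnellWaldspurgerProofs`
  (`Literature.NumberTheory.EllipticCurves.Tunnell1983_L_one_even_of_facts` / `_odd_`: Waldspurger's proportionality on the odd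
  classes modulo `8`, p. 329, and the Birch–Swinnerton-Dyer 1965 values `L(E², 1)`, `L(E¹⁰, 1)`,
  resp. `L(E, 1)`, `L(E³, 1)`).

So `Literature.NumberTheory.EllipticCurves.tunnell_even_of_leaves` / `tunnell_odd_of_leaves` display, machine-checked, exactly
which named facts `Literature.BSD.tunnell_even_holds` / `tunnell_odd_holds` currently stand behind:

1. `Literature.NumberTheory.EllipticCurves.CoatesWiles1977_L_one_div_period_mem_prime` (Coates–Wiles 1977, §6 p. 250),
2. `Literature.NumberTheory.EllipticCurves.Deuring1941_frobeniusTrace_eq_add_conj` (Deuring 1941; Cox Thm. 14.16),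
3. `Literature.NumberTheory.EllipticCurves.exists_isCMPeriod_of_j_mem_maximalCMJInvariants` (Coates–Wiles §1 p. 225),
4. `Literature.NumberTheory.EllipticCurves.Tunnell1983_b_sq_eq_const_mul_L_one`, resp. `Literature.NumberTheory.EllipticCurves.Tunnell1983_a_sq_eq_const_mul_L_one`
   (Tunnell 1983 p. 329 via Waldspurger 1981, Thm 1, and the Shimura lifts of Thm 2),
5. `Literature.NumberTheory.EllipticCurves.BirchSwinnertonDyer1965_L_one_two_ten`, resp. `Literature.NumberTheory.EllipticCurves.BirchSwinnertonDyer1965_L_one_one_three`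
   (Birch–Swinnerton-Dyer 1965, (1.6) and Table 1),
6. `Literature.NumberTheory.EllipticCurves.hasEntireLFunction_congruentNumberCurve` (continuation of `L(E_n, s)`, `n` squarefree;
   Koblitz Ch. II §5 / Ireland–Rosen Ch. 18, being decomposed in
   `CongruentNumberCurveSupersingular`).

Nothing is restated and nothing new is assumed: both theorems are compositions of tree theorems.

## References

* J. B. Tunnell, Invent. Math. 72 (1983) 323–334, §3 p. 329. [Tunnell1983Congruent]
* J. Coates, A. Wiles, Invent. Math. 39 (1977), Thm 1. [CoatesWiles1977]
* B. J. Birch, H. P. F. Swinnerton-Dyer, J. reine angew. Math. 218 (1965). [BirchSwinnertonDyer1965NotesII]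
-/

noncomputable section

open scoped Classical

open WeierstrassCurve

namespace Literature.NumberTheory.EllipticCurves

/-- **`Literature.NumberTheory.EllipticCurves.tunnell_even` from the current leaves** (Tunnell 1983, §3, p. 329): Coates–Wiles'
per-prime divisibility (`h1`), Deuring's trace formula (`h2`), the CM period (`h3`) — giving
Coates–Wiles, Thm 1, by `finite_point_of_j_mem_maximalCMJInvariants_of_L_one_ne_zero_of_mem_prime` —,
Waldspurger's proportionality for `g θ₄` (`hW`) and the values `L(E², 1)`, `L(E¹⁰, 1)` (`hV`) —
giving Theorem 3 for even twists by `Tunnell1983_L_one_even_of_facts` —, and the continuation of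
`L(E_n, s)` for squarefree `n` (`hL`); assembled by `tunnell_even_of_facts`.
[cite: Tunnell1983Congruent, §3 (p. 329)] -/
theorem tunnell_even_of_leaves (h1 : CoatesWiles1977_L_one_div_period_mem_prime)
    (h2 : Deuring1941_frobeniusTrace_eq_add_conj)
    (h3 : exists_isCMPeriod_of_j_mem_maximalCMJInvariants)
    (hW : Literature.NumberTheory.EllipticCurves.Tunnell1983_b_sq_eq_const_mul_L_one)
    (hV : Literature.NumberTheory.EllipticCurves.BirchSwinnertonDyer1965_L_one_two_ten)
    (hL : Literature.NumberTheory.EllipticCurves.hasEntireLFunction_congruentNumberCurve) : tunnell_even :=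
  tunnell_even_of_facts
    (finite_point_of_j_mem_maximalCMJInvariants_of_L_one_ne_zero_of_mem_prime h1 h2 h3) hL
    (Literature.NumberTheory.EllipticCurves.Tunnell1983_L_one_even_of_facts hW hV hL)

/-- **`Literature.NumberTheory.EllipticCurves.tunnell_odd` from the current leaves** (Tunnell 1983, §3, p. 329): as
`tunnell_even_of_leaves`, with Waldspurger's proportionality for `g θ₂` (`hW`) and the values
`L(E, 1)`, `L(E³, 1)` (`hV`), through `Tunnell1983_L_one_odd_of_facts` and `tunnell_odd_of_facts`.
[cite: Tunnell1983Congruent, §3 (p. 329)] -/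
theorem tunnell_odd_of_leaves (h1 : CoatesWiles1977_L_one_div_period_mem_prime)
    (h2 : Deuring1941_frobeniusTrace_eq_add_conj)
    (h3 : exists_isCMPeriod_of_j_mem_maximalCMJInvariants)
    (hW : Literature.NumberTheory.EllipticCurves.Tunnell1983_a_sq_eq_const_mul_L_one)
    (hV : Literature.NumberTheory.EllipticCurves.BirchSwinnertonDyer1965_L_one_one_three)
    (hL : Literature.NumberTheory.EllipticCurves.hasEntireLFunction_congruentNumberCurve) : tunnell_odd :=
  tunnell_odd_of_facts
    (finite_point_of_j_mem_maximalCMJInvariants_of_L_one_ne_zero_of_mem_prime h1 h2 h3) hL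
    (Literature.NumberTheory.EllipticCurves.Tunnell1983_L_one_odd_of_facts hW hV hL)

end Literature.NumberTheory.EllipticCurves

end
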